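import Mathlib
import HarnessLib
import Summits.HubbardSuperconductivity.HubbardSuperconductivity.Theorems.KLProgrammeKLRegimeEnginePairTransferMemberResolvedDefect
import Summits.HubbardSuperconductivity.HubbardSuperconductivity.Theorems.KLProgrammeKLRegimeEnginePairTransferMemberDefectDiffClasses

/-!
# Route `KLProgramme` — ENGINE child gen 8 (stmt-HubbardSuperconductivity-20437 `KLRegimeEngineV17F2`), skeleton v2 class #5 rev 3: the DIFFERENCE of two members' PINNED
# Riccati defects, keyed on the model and SPLIT into `D`-carrying classes — **`klmd_pinnedDefect_sub_eq`**
# (cell gate-hubbard-kl, seat hubbard-kl-k3c1-p1 g13, technique «composed-map remainder propagation»; = `klmd_pinnedDefect_eq_resolved` ×2 + `…MemberDefectDiffClasses`)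

WHY.  Rows 29/30 of KLTC-INDEX v9.1 (`pairTransferRelResIdx_family_succ_of_analytic_split`, `…Step7AnalyticModel`) take the RELATIVE source of the class-#5 STEP as ONE row
`‖(S_j − S_{j′})(t)(x,y)‖ ≤ ξΔ`, `Sᵢ = Ȧᵢ + Aᵢ·diag ḃᵢ·Aᵢ` the PINNED Riccati defects of the two members `s_{n+1,j} | s_{n+1,j′}` of frame `K_{n+1}`.  Located reading
«(ξΔ)-TRIANGLE» (k3c1-p1 g13): the triangle route through the ladder (`klmf_defect_sub_le`) leaves the un-gained term `mA²·Σ‖ḃ_j − ḃ_{j′}‖ ≍ mA²·O(10³)·ms`, which is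
not n-uniformly inside the slice ROOM `θ·r·(KlamU)²·(2⁻ⁿ + 3/L + …)·ms`; the cure is to subtract the ladder EXACTLY in each member (`klmd_pinnedDefect_eq_resolved`) and to
difference the RESOLVED classes (`klmd_phd_sub_eq` & co.).  This file is that composition, keyed on the model:
**`klmd_pinnedDefect_sub_eq`** — for two members `ψ₁ ψ₂` (even in the frequency) of the same frame `K`, slice `n+1`, pair momentum `Qm`:
`(S₁ − S₂)(t)(x,y) = 𝟙_ball·((Λ_{n+1}−Λₙ)·[−½(Hd₁ − Hd₂) − (βL²)⁻³((SD₁ + SD₂) − (SX₁ + SX₂) − 2(S6₁ + S6₂))] + (SL₁ + SL₂))` where, EXACTLY and with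
`D = ψ₁ − ψ₂` LITERAL: `SD₁/SX₁/S6₁` = ph-direct / ph-crossed / 6–2 sums with the `D`-WEIGHT (`D`-line against the slice line `ẇ` at transfer `x − y` / `x + y − Qm` /
born overlap) on member-1 kernels; `SD₂/SX₂/S6₂` = member-2 weights against the DIFFERENCE of the two carriers' kernels (`V₁V₁ − V₂V₂`, `V6₁Sg₁ − V6₂Sg₂`; each
`= (e^{Δ_{S_D}} − 1)`-type by `klmf_vertexFn_carrier_sub_eq`); `SL₁` = the `D`-rung rate (`B(ẇ,D)`-type) against member-1's localisation kernel; `SL₂` = member-2's rate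
against the difference of the localisation kernels.  For the family pair `D = s_{n+1,j} − s_{n+1,j′} = s_{j′,j}` (`softSymbolCompl_sub_compl`) — a deep complementary
shell of index mass `klIdxMass n j′` (`klSoftMass_compl_sub_compl_le_klIdxMass`).  The norm door on nine rows is `klmd_defectDiff_le_rows` (companion file).
Exact algebra over landed identities; the SIZE of every class stays the analytic lanes' ((c) closer / k3c2-p2 / class #1); nothing asserts (X).3, (c), K3 or
superconductivity.  0 kit · 0 lit.
-/

noncomputable section

namespace Summit.HubbardSuperconductivity.HubbardSuperconductivity.Theorems.KLRegimeSplit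

set_option linter.dupNamespace false -- summit = problem name (single-conjunct summit), D-0017

open Finset Matrix Set Literature.MathematicalPhysics.QuantumLattice Literature.Probability.LatticeModels GrassmannAlgebra
open Summit.HubbardSuperconductivity.HubbardSuperconductivity.Theorems.KLProgrammeLegKernels
open Summit.HubbardSuperconductivity.HubbardSuperconductivity.Theorems.TwoPointAssembly
open Summit.HubbardSuperconductivity.HubbardSuperconductivity.Theorems.DispersionFlow
open Summit.HubbardSuperconductivity.HubbardSuperconductivity.Theorems.KLRegimeWick

variable (L M : ℕ) [NeZero L] [NeZero M] (β U μ : ℝ) (K : TrigPolyC4v)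

set_option maxHeartbeats 1600000 in -- two instantiated `klmd_pinnedDefect_eq_resolved` identities + the class algebra; plumbing only
/-- **`klmd_pinnedDefect_sub_eq`** — the difference of two members' PINNED Riccati defects as `𝟙_ball`·(the `D`-split), see the module docstring.  Binders: `β ≠ 0`,
members `ψ₁ ψ₂` even in the frequency, pair momentum `Qm`; per member the door curves `Aᵢ Ȧᵢ ḃᵢ` (`klmf_memberArray_flowData` / `klmf_rung_data` shapes, pass
`rfl ×3`) and the abstract kernels `Vᵢ V6ᵢ Sgᵢ Hdᵢ Φᵢ Brᵢ` pinned by `rfl` (as in `klmd_pinnedDefect_eq_resolved`); the shared slice derivative `Wd` (`rfl`);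
`t ∈ [0,1]`, sites `x y`. -/
theorem klmd_pinnedDefect_sub_eq (hβ : β ≠ 0) (n : ℕ) {ψ₁ ψ₂ : FreqMomentum L M → ℝ}
    (hψ₁ : ∀ k : FreqMomentum L M, ψ₁ (k.1.rev, k.2) = ψ₁ k) (hψ₂ : ∀ k : FreqMomentum L M, ψ₂ (k.1.rev, k.2) = ψ₂ k) (Qm : TorusSite 2 L)
    (Wd : ℝ → FreqMomentum L M → ℝ) (hWd : Wd = fun t k => deriv (fun Λ' : ℝ => hubbardCutoffWeightCT L M β μ K Λ' k) (klScale klE0 n + t * (klScale klE0 (n + 1) - klScale klE0 n)))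
    (A₁ A₁' : ℝ → Matrix (TorusSite 2 L) (TorusSite 2 L) ℂ) (b₁' : ℝ → TorusSite 2 L → ℂ)
    (hA₁def : A₁ = fun t => Matrix.of fun k k' : TorusSite 2 L => if k ∈ klBall L μ 0 ∧ k' ∈ klBall L μ 0 then
      vertexFn L M β (gaussConv ℂ (softCovOf L M β μ K ψ₁ + hubbardCovAboveCT L M β μ 0 K (klScale klE0 (n + 1)) - hubbardCovAboveCT L M β μ 0 K (klScale klE0 n + t * (klScale klE0 (n
              + 1) - klScale klE0 n))) (hubbardEffectiveActionCT L M β U μ 0 K (klScale klE0 n + t * (klScale klE0 (n + 1) - klScale klE0 n)))) 4 ![(((omega0 M, k'), 0), 0), ((((omega0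
              M).rev, Qm - k'), 1), 0), ((((omega0 M).rev, Qm - k), 1), 1), (((omega0 M, k), 0), 1)]
      else 0)
    (hA₁'def : A₁' = fun t => Matrix.of fun k k' : TorusSite 2 L => if k ∈ klBall L μ 0 ∧ k' ∈ klBall L μ 0 then
      (klScale klE0 (n + 1) - klScale klE0 n) • -((2 : ℂ)⁻¹ * vertexFn L M β (gaussConv ℂ (softCovOf L M β μ K ψ₁ + hubbardCovAboveCT L M β μ 0 K (klScale klE0 (n + 1)) -
              hubbardCovAboveCT L M β μ 0 K (klScale klE0 n + t * (klScale klE0 (n + 1) - klScale klE0 n))) (grassmannDerivPairing ℂ (Matrix.of fun X Y : HubbardFieldIdx L M => deriv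
              (fun Λ'' : ℝ => hubbardCovAboveCT L M β μ 0 K Λ'' X Y) (klScale klE0 n + t * (klScale klE0 (n + 1) - klScale klE0 n))) (hubbardEffectiveActionCT L M β U μ 0 K (klScale
              klE0 n + t * (klScale klE0 (n + 1) - klScale klE0 n))) (hubbardEffectiveActionCT L M β U μ 0 K (klScale klE0 n + t * (klScale klE0 (n + 1) - klScale klE0 n))))) 4
              ![(((omega0 M, k'), 0), 0), ((((omega0 M).rev, Qm - k'), 1), 0), ((((omega0 M).rev, Qm - k), 1), 1), (((omega0 M, k), 0), 1)])
      else 0)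
    (hb₁'def : b₁' = fun (t : ℝ) (p : TorusSite 2 L) => (((klScale klE0 (n + 1) - klScale klE0 n) *
        (klBubbleMass L M β μ K (fun k => deriv (fun Λ' => hubbardCutoffWeightCT L M β μ K Λ' k) (klScale klE0 n + t * (klScale klE0 (n + 1) - klScale klE0 n))) (fun k => ψ₁ k +
                (hubbardCutoffWeightCT L M β μ K (klScale klE0 (n + 1)) k - hubbardCutoffWeightCT L M β μ K (klScale klE0 n + t * (klScale klE0 (n + 1) - klScale klE0 n)) k)) Qm p +
          klBubbleMass L M β μ K (fun k => ψ₁ k + (hubbardCutoffWeightCT L M β μ K (klScale klE0 (n + 1)) k - hubbardCutoffWeightCT L M β μ K (klScale klE0 n + t * (klScale klE0 (n +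
                  1) - klScale klE0 n)) k)) (fun k => deriv (fun Λ' => hubbardCutoffWeightCT L M β μ K Λ' k) (klScale klE0 n + t * (klScale klE0 (n + 1) - klScale klE0 n))) Qm p) : ℝ)
                  : ℂ))
    (V₁ : ℝ → (Fin 4 → HubbardFieldIdx L M) → ℂ) (hV₁ : V₁ = fun t X => vertexFn L M β (gaussConv ℂ (softCovOf L M β μ K ψ₁ + hubbardCovAboveCT L M β μ 0 K (klScale klE0 (n + 1)) -
            hubbardCovAboveCT L M β μ 0 K (klScale klE0 n + t * (klScale klE0 (n + 1) - klScale klE0 n))) (hubbardEffectiveActionCT L M β U μ 0 K (klScale klE0 n + t * (klScale klE0 (n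
            + 1) - klScale klE0 n)))) 4 X)
    (V6₁ : ℝ → (Fin 6 → HubbardFieldIdx L M) → ℂ) (hV6₁ : V6₁ = fun t X => vertexFn L M β (gaussConv ℂ (softCovOf L M β μ K ψ₁ + hubbardCovAboveCT L M β μ 0 K (klScale klE0 (n + 1)) -
            hubbardCovAboveCT L M β μ 0 K (klScale klE0 n + t * (klScale klE0 (n + 1) - klScale klE0 n))) (hubbardEffectiveActionCT L M β U μ 0 K (klScale klE0 n + t * (klScale klE0 (n
            + 1) - klScale klE0 n)))) 6 X)
    (Sg₁ : ℝ → FreqMomentum L M → Fin 2 → ℂ) (hSg₁ : Sg₁ = fun t p σ => selfEnergy L M β (gaussConv ℂ (softCovOf L M β μ K ψ₁ + hubbardCovAboveCT L M β μ 0 K (klScale klE0 (n + 1)) -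
            hubbardCovAboveCT L M β μ 0 K (klScale klE0 n + t * (klScale klE0 (n + 1) - klScale klE0 n))) (hubbardEffectiveActionCT L M β U μ 0 K (klScale klE0 n + t * (klScale klE0 (n
            + 1) - klScale klE0 n)))) p σ)
    (Hd₁ : ℝ → (Fin 4 → HubbardFieldIdx L M) → ℂ) (hHd₁ : Hd₁ = fun t X => vertexFn L M β (dblFold ℂ (grassmannLaplacian ℂ (crossCov ℂ (Matrix.of fun X Y : HubbardFieldIdx L M => deriv
            (fun Λ' : ℝ => hubbardCovAboveCT L M β μ 0 K Λ' X Y) (klScale klE0 n + t * (klScale klE0 (n + 1) - klScale klE0 n)))) ((gaussConv ℂ (crossCov ℂ (softCovOf L M β μ K ψ₁ +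
            hubbardCovAboveCT L M β μ 0 K (klScale klE0 (n + 1)) - hubbardCovAboveCT L M β μ 0 K (klScale klE0 n + t * (klScale klE0 (n + 1) - klScale klE0 n)))) - grassmannLaplacian ℂ
            (crossCov ℂ (softCovOf L M β μ K ψ₁ + hubbardCovAboveCT L M β μ 0 K (klScale klE0 (n + 1)) - hubbardCovAboveCT L M β μ 0 K (klScale klE0 n + t * (klScale klE0 (n + 1) -
            klScale klE0 n))))) (dblCopy ℂ 0 (gaussConv ℂ (softCovOf L M β μ K ψ₁ + hubbardCovAboveCT L M β μ 0 K (klScale klE0 (n + 1)) - hubbardCovAboveCT L M β μ 0 K (klScale klE0 n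
            + t * (klScale klE0 (n + 1) - klScale klE0 n))) (hubbardEffectiveActionCT L M β U μ 0 K (klScale klE0 n + t * (klScale klE0 (n + 1) - klScale klE0 n)))) * dblCopy ℂ 1
            (gaussConv ℂ (softCovOf L M β μ K ψ₁ + hubbardCovAboveCT L M β μ 0 K (klScale klE0 (n + 1)) - hubbardCovAboveCT L M β μ 0 K (klScale klE0 n + t * (klScale klE0 (n + 1) -
            klScale klE0 n))) (hubbardEffectiveActionCT L M β U μ 0 K (klScale klE0 n + t * (klScale klE0 (n + 1) - klScale klE0 n)))))))) 4 X)
    (Φ₁ : ℝ → FreqMomentum L M → ℝ) (hΦ₁ : Φ₁ = fun t k => ψ₁ k + (hubbardCutoffWeightCT L M β μ K (klScale klE0 (n + 1)) k - hubbardCutoffWeightCT L M β μ K (klScale klE0 n + t *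
            (klScale klE0 (n + 1) - klScale klE0 n)) k))
    (Br₁ : ℝ → TorusSite 2 L × MatsubaraIdx M → ℂ) (hBr₁ : Br₁ = fun t z => -(((((β * (L : ℝ) ^ 2 : ℝ) : ℂ)))⁻¹ * propCT L M β μ K (z.2, z.1) * propCT L M β μ K (z.2.rev, Qm - z.1)) *
      ((((klScale klE0 (n + 1) - klScale klE0 n) * (-Wd t (z.2, z.1) * Φ₁ t (z.2.rev, Qm - z.1) - Φ₁ t (z.2, z.1) * Wd t (z.2.rev, Qm - z.1))) : ℝ) : ℂ))
    (A₂ A₂' : ℝ → Matrix (TorusSite 2 L) (TorusSite 2 L) ℂ) (b₂' : ℝ → TorusSite 2 L → ℂ)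
    (hA₂def : A₂ = fun t => Matrix.of fun k k' : TorusSite 2 L => if k ∈ klBall L μ 0 ∧ k' ∈ klBall L μ 0 then
      vertexFn L M β (gaussConv ℂ (softCovOf L M β μ K ψ₂ + hubbardCovAboveCT L M β μ 0 K (klScale klE0 (n + 1)) - hubbardCovAboveCT L M β μ 0 K (klScale klE0 n + t * (klScale klE0 (n
              + 1) - klScale klE0 n))) (hubbardEffectiveActionCT L M β U μ 0 K (klScale klE0 n + t * (klScale klE0 (n + 1) - klScale klE0 n)))) 4 ![(((omega0 M, k'), 0), 0), ((((omega0
              M).rev, Qm - k'), 1), 0), ((((omega0 M).rev, Qm - k), 1), 1), (((omega0 M, k), 0), 1)]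
      else 0)
    (hA₂'def : A₂' = fun t => Matrix.of fun k k' : TorusSite 2 L => if k ∈ klBall L μ 0 ∧ k' ∈ klBall L μ 0 then
      (klScale klE0 (n + 1) - klScale klE0 n) • -((2 : ℂ)⁻¹ * vertexFn L M β (gaussConv ℂ (softCovOf L M β μ K ψ₂ + hubbardCovAboveCT L M β μ 0 K (klScale klE0 (n + 1)) -
              hubbardCovAboveCT L M β μ 0 K (klScale klE0 n + t * (klScale klE0 (n + 1) - klScale klE0 n))) (grassmannDerivPairing ℂ (Matrix.of fun X Y : HubbardFieldIdx L M => deriv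
              (fun Λ'' : ℝ => hubbardCovAboveCT L M β μ 0 K Λ'' X Y) (klScale klE0 n + t * (klScale klE0 (n + 1) - klScale klE0 n))) (hubbardEffectiveActionCT L M β U μ 0 K (klScale
              klE0 n + t * (klScale klE0 (n + 1) - klScale klE0 n))) (hubbardEffectiveActionCT L M β U μ 0 K (klScale klE0 n + t * (klScale klE0 (n + 1) - klScale klE0 n))))) 4
              ![(((omega0 M, k'), 0), 0), ((((omega0 M).rev, Qm - k'), 1), 0), ((((omega0 M).rev, Qm - k), 1), 1), (((omega0 M, k), 0), 1)])
      else 0)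
    (hb₂'def : b₂' = fun (t : ℝ) (p : TorusSite 2 L) => (((klScale klE0 (n + 1) - klScale klE0 n) *
        (klBubbleMass L M β μ K (fun k => deriv (fun Λ' => hubbardCutoffWeightCT L M β μ K Λ' k) (klScale klE0 n + t * (klScale klE0 (n + 1) - klScale klE0 n))) (fun k => ψ₂ k +
                (hubbardCutoffWeightCT L M β μ K (klScale klE0 (n + 1)) k - hubbardCutoffWeightCT L M β μ K (klScale klE0 n + t * (klScale klE0 (n + 1) - klScale klE0 n)) k)) Qm p +
          klBubbleMass L M β μ K (fun k => ψ₂ k + (hubbardCutoffWeightCT L M β μ K (klScale klE0 (n + 1)) k - hubbardCutoffWeightCT L M β μ K (klScale klE0 n + t * (klScale klE0 (n +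
                  1) - klScale klE0 n)) k)) (fun k => deriv (fun Λ' => hubbardCutoffWeightCT L M β μ K Λ' k) (klScale klE0 n + t * (klScale klE0 (n + 1) - klScale klE0 n))) Qm p) : ℝ)
                  : ℂ))
    (V₂ : ℝ → (Fin 4 → HubbardFieldIdx L M) → ℂ) (hV₂ : V₂ = fun t X => vertexFn L M β (gaussConv ℂ (softCovOf L M β μ K ψ₂ + hubbardCovAboveCT L M β μ 0 K (klScale klE0 (n + 1)) -
            hubbardCovAboveCT L M β μ 0 K (klScale klE0 n + t * (klScale klE0 (n + 1) - klScale klE0 n))) (hubbardEffectiveActionCT L M β U μ 0 K (klScale klE0 n + t * (klScale klE0 (n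
            + 1) - klScale klE0 n)))) 4 X)
    (V6₂ : ℝ → (Fin 6 → HubbardFieldIdx L M) → ℂ) (hV6₂ : V6₂ = fun t X => vertexFn L M β (gaussConv ℂ (softCovOf L M β μ K ψ₂ + hubbardCovAboveCT L M β μ 0 K (klScale klE0 (n + 1)) -
            hubbardCovAboveCT L M β μ 0 K (klScale klE0 n + t * (klScale klE0 (n + 1) - klScale klE0 n))) (hubbardEffectiveActionCT L M β U μ 0 K (klScale klE0 n + t * (klScale klE0 (n
            + 1) - klScale klE0 n)))) 6 X)
    (Sg₂ : ℝ → FreqMomentum L M → Fin 2 → ℂ) (hSg₂ : Sg₂ = fun t p σ => selfEnergy L M β (gaussConv ℂ (softCovOf L M β μ K ψ₂ + hubbardCovAboveCT L M β μ 0 K (klScale klE0 (n + 1)) -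
            hubbardCovAboveCT L M β μ 0 K (klScale klE0 n + t * (klScale klE0 (n + 1) - klScale klE0 n))) (hubbardEffectiveActionCT L M β U μ 0 K (klScale klE0 n + t * (klScale klE0 (n
            + 1) - klScale klE0 n)))) p σ)
    (Hd₂ : ℝ → (Fin 4 → HubbardFieldIdx L M) → ℂ) (hHd₂ : Hd₂ = fun t X => vertexFn L M β (dblFold ℂ (grassmannLaplacian ℂ (crossCov ℂ (Matrix.of fun X Y : HubbardFieldIdx L M => deriv
            (fun Λ' : ℝ => hubbardCovAboveCT L M β μ 0 K Λ' X Y) (klScale klE0 n + t * (klScale klE0 (n + 1) - klScale klE0 n)))) ((gaussConv ℂ (crossCov ℂ (softCovOf L M β μ K ψ₂ +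
            hubbardCovAboveCT L M β μ 0 K (klScale klE0 (n + 1)) - hubbardCovAboveCT L M β μ 0 K (klScale klE0 n + t * (klScale klE0 (n + 1) - klScale klE0 n)))) - grassmannLaplacian ℂ
            (crossCov ℂ (softCovOf L M β μ K ψ₂ + hubbardCovAboveCT L M β μ 0 K (klScale klE0 (n + 1)) - hubbardCovAboveCT L M β μ 0 K (klScale klE0 n + t * (klScale klE0 (n + 1) -
            klScale klE0 n))))) (dblCopy ℂ 0 (gaussConv ℂ (softCovOf L M β μ K ψ₂ + hubbardCovAboveCT L M β μ 0 K (klScale klE0 (n + 1)) - hubbardCovAboveCT L M β μ 0 K (klScale klE0 n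
            + t * (klScale klE0 (n + 1) - klScale klE0 n))) (hubbardEffectiveActionCT L M β U μ 0 K (klScale klE0 n + t * (klScale klE0 (n + 1) - klScale klE0 n)))) * dblCopy ℂ 1
            (gaussConv ℂ (softCovOf L M β μ K ψ₂ + hubbardCovAboveCT L M β μ 0 K (klScale klE0 (n + 1)) - hubbardCovAboveCT L M β μ 0 K (klScale klE0 n + t * (klScale klE0 (n + 1) -
            klScale klE0 n))) (hubbardEffectiveActionCT L M β U μ 0 K (klScale klE0 n + t * (klScale klE0 (n + 1) - klScale klE0 n)))))))) 4 X)
    (Φ₂ : ℝ → FreqMomentum L M → ℝ) (hΦ₂ : Φ₂ = fun t k => ψ₂ k + (hubbardCutoffWeightCT L M β μ K (klScale klE0 (n + 1)) k - hubbardCutoffWeightCT L M β μ K (klScale klE0 n + t *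
            (klScale klE0 (n + 1) - klScale klE0 n)) k))
    (Br₂ : ℝ → TorusSite 2 L × MatsubaraIdx M → ℂ) (hBr₂ : Br₂ = fun t z => -(((((β * (L : ℝ) ^ 2 : ℝ) : ℂ)))⁻¹ * propCT L M β μ K (z.2, z.1) * propCT L M β μ K (z.2.rev, Qm - z.1)) *
      ((((klScale klE0 (n + 1) - klScale klE0 n) * (-Wd t (z.2, z.1) * Φ₂ t (z.2.rev, Qm - z.1) - Φ₂ t (z.2, z.1) * Wd t (z.2.rev, Qm - z.1))) : ℝ) : ℂ))
    {t : ℝ} (ht : t ∈ Icc (0 : ℝ) 1) (x y : TorusSite 2 L) :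
    (A₁' t + A₁ t * diagonal (b₁' t) * A₁ t) x y - (A₂' t + A₂ t * diagonal (b₂' t) * A₂ t) x y =
      if x ∈ klBall L μ 0 ∧ y ∈ klBall L μ 0 then
        ((((klScale klE0 (n + 1) - klScale klE0 n)) : ℝ) : ℂ) *
          (-((2 : ℂ)⁻¹ * (Hd₁ t ![(((omega0 M, y), 0), 0), ((((omega0 M).rev, Qm - y), 1), 0), ((((omega0 M).rev, Qm - x), 1), 1), (((omega0 M, x), 0), 1)] - Hd₂ t ![(((omega0 M, y),
                  0), 0), ((((omega0 M).rev, Qm - y), 1), 0), ((((omega0 M).rev, Qm - x), 1), 1), (((omega0 M, x), 0), 1)])) -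
            ((((β * (L : ℝ) ^ 2 : ℝ) : ℂ)) ^ 3)⁻¹ *
              (((∑ p : FreqMomentum L M, ∑ σ : Fin 2, ∑ p' : FreqMomentum L M,
            if matsubaraInt M p'.1 + matsubaraInt M (omega0 M) = matsubaraInt M p.1 + matsubaraInt M (omega0 M) ∧ p'.2 = p.2 + x - y then
              (((((((ψ₁ p - ψ₂ p)) : ℝ) : ℂ) * (((β * (L : ℝ) ^ 2 : ℝ) : ℂ) * propCT L M β μ K p)) * ((((Wd t p') : ℝ) : ℂ) * (((β * (L : ℝ) ^ 2 : ℝ) : ℂ) * propCT L M β μ K p'))) +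
                      (((((Wd t p) : ℝ) : ℂ) * (((β * (L : ℝ) ^ 2 : ℝ) : ℂ) * propCT L M β μ K p)) * (((((ψ₁ p' - ψ₂ p')) : ℝ) : ℂ) * (((β * (L : ℝ) ^ 2 : ℝ) : ℂ) * propCT L M β μ K
                      p')))) *
                (V₁ t ![((p, σ), 1), ((p', σ), 0), (((omega0 M, y), 0), 0), (((omega0 M, x), 0), 1)] *
                  V₁ t ![((p, σ), 0), ((p', σ), 1), ((((omega0 M).rev, Qm - y), 1), 0), ((((omega0 M).rev, Qm - x), 1), 1)])
            else 0) +
                (∑ p : FreqMomentum L M, ∑ σ : Fin 2, ∑ p' : FreqMomentum L M,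
            if matsubaraInt M p'.1 + matsubaraInt M (omega0 M) = matsubaraInt M p.1 + matsubaraInt M (omega0 M) ∧ p'.2 = p.2 + x - y then
              ((((((Φ₂ t p) : ℝ) : ℂ) * (((β * (L : ℝ) ^ 2 : ℝ) : ℂ) * propCT L M β μ K p)) * ((((Wd t p') : ℝ) : ℂ) * (((β * (L : ℝ) ^ 2 : ℝ) : ℂ) * propCT L M β μ K p'))) + (((((Wd t
                      p) : ℝ) : ℂ) * (((β * (L : ℝ) ^ 2 : ℝ) : ℂ) * propCT L M β μ K p)) * ((((Φ₂ t p') : ℝ) : ℂ) * (((β * (L : ℝ) ^ 2 : ℝ) : ℂ) * propCT L M β μ K p')))) *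
                (V₁ t ![((p, σ), 1), ((p', σ), 0), (((omega0 M, y), 0), 0), (((omega0 M, x), 0), 1)] *
                  V₁ t ![((p, σ), 0), ((p', σ), 1), ((((omega0 M).rev, Qm - y), 1), 0), ((((omega0 M).rev, Qm - x), 1), 1)] -
                V₂ t ![((p, σ), 1), ((p', σ), 0), (((omega0 M, y), 0), 0), (((omega0 M, x), 0), 1)] *
                  V₂ t ![((p, σ), 0), ((p', σ), 1), ((((omega0 M).rev, Qm - y), 1), 0), ((((omega0 M).rev, Qm - x), 1), 1)])
            else 0)) -
                ((∑ p : FreqMomentum L M, ∑ p' : FreqMomentum L M,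
            if matsubaraInt M p'.1 + matsubaraInt M (omega0 M) + matsubaraInt M (omega0 M) + 1 = matsubaraInt M p.1 ∧ p'.2 = p.2 + Qm - x - y then
              (((((((ψ₁ p - ψ₂ p)) : ℝ) : ℂ) * (((β * (L : ℝ) ^ 2 : ℝ) : ℂ) * propCT L M β μ K p)) * ((((Wd t p') : ℝ) : ℂ) * (((β * (L : ℝ) ^ 2 : ℝ) : ℂ) * propCT L M β μ K p'))) +
                      (((((Wd t p) : ℝ) : ℂ) * (((β * (L : ℝ) ^ 2 : ℝ) : ℂ) * propCT L M β μ K p)) * (((((ψ₁ p' - ψ₂ p')) : ℝ) : ℂ) * (((β * (L : ℝ) ^ 2 : ℝ) : ℂ) * propCT L M β μ K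
                      p')))) *
                (V₁ t ![((p, 0), 1), ((p', 1), 0), (((omega0 M, y), 0), 0), ((((omega0 M).rev, Qm - x), 1), 1)] *
                  V₁ t ![((p, 0), 0), ((p', 1), 1), ((((omega0 M).rev, Qm - y), 1), 0), (((omega0 M, x), 0), 1)])
            else 0) +
                (∑ p : FreqMomentum L M, ∑ p' : FreqMomentum L M,
            if matsubaraInt M p'.1 + matsubaraInt M (omega0 M) + matsubaraInt M (omega0 M) + 1 = matsubaraInt M p.1 ∧ p'.2 = p.2 + Qm - x - y then
              ((((((Φ₂ t p) : ℝ) : ℂ) * (((β * (L : ℝ) ^ 2 : ℝ) : ℂ) * propCT L M β μ K p)) * ((((Wd t p') : ℝ) : ℂ) * (((β * (L : ℝ) ^ 2 : ℝ) : ℂ) * propCT L M β μ K p'))) + (((((Wd t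
                      p) : ℝ) : ℂ) * (((β * (L : ℝ) ^ 2 : ℝ) : ℂ) * propCT L M β μ K p)) * ((((Φ₂ t p') : ℝ) : ℂ) * (((β * (L : ℝ) ^ 2 : ℝ) : ℂ) * propCT L M β μ K p')))) *
                (V₁ t ![((p, 0), 1), ((p', 1), 0), (((omega0 M, y), 0), 0), ((((omega0 M).rev, Qm - x), 1), 1)] *
                  V₁ t ![((p, 0), 0), ((p', 1), 1), ((((omega0 M).rev, Qm - y), 1), 0), (((omega0 M, x), 0), 1)] -
                V₂ t ![((p, 0), 1), ((p', 1), 0), (((omega0 M, y), 0), 0), ((((omega0 M).rev, Qm - x), 1), 1)] *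
                  V₂ t ![((p, 0), 0), ((p', 1), 1), ((((omega0 M).rev, Qm - y), 1), 0), (((omega0 M, x), 0), 1)])
            else 0)) -
                2 * ((∑ p : FreqMomentum L M, ∑ σ : Fin 2,
            (((((Wd t p) : ℝ) : ℂ) * (((β * (L : ℝ) ^ 2 : ℝ) : ℂ) * propCT L M β μ K p)) * (((((ψ₁ p - ψ₂ p)) : ℝ) : ℂ) * (((β * (L : ℝ) ^ 2 : ℝ) : ℂ) * propCT L M β μ K p))) *
              (V6₁ t ![((p, σ), 0), ((p, σ), 1), (((omega0 M, y), 0), 0), ((((omega0 M).rev, Qm - y), 1), 0), ((((omega0 M).rev, Qm - x), 1), 1),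
                (((omega0 M, x), 0), 1)] *
                Sg₁ t p σ)) +
                (∑ p : FreqMomentum L M, ∑ σ : Fin 2,
            (((((Wd t p) : ℝ) : ℂ) * (((β * (L : ℝ) ^ 2 : ℝ) : ℂ) * propCT L M β μ K p)) * ((((Φ₂ t p) : ℝ) : ℂ) * (((β * (L : ℝ) ^ 2 : ℝ) : ℂ) * propCT L M β μ K p))) *
              (V6₁ t ![((p, σ), 0), ((p, σ), 1), (((omega0 M, y), 0), 0), ((((omega0 M).rev, Qm - y), 1), 0), ((((omega0 M).rev, Qm - x), 1), 1),
                (((omega0 M, x), 0), 1)] *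
                Sg₁ t p σ -
              V6₂ t ![((p, σ), 0), ((p, σ), 1), (((omega0 M, y), 0), 0), ((((omega0 M).rev, Qm - y), 1), 0), ((((omega0 M).rev, Qm - x), 1), 1),
                (((omega0 M, x), 0), 1)] *
                Sg₂ t p σ))))) +
        (∑ z : TorusSite 2 L × MatsubaraIdx M, (fun z : TorusSite 2 L × MatsubaraIdx M => -(((((β * (L : ℝ) ^ 2 : ℝ) : ℂ)))⁻¹ * propCT L M β μ K (z.2, z.1) * propCT L M β μ K (z.2.rev,
                Qm - z.1)) * ((((klScale klE0 (n + 1) - klScale klE0 n) * (-Wd t (z.2, z.1) * (ψ₁ (z.2.rev, Qm - z.1) - ψ₂ (z.2.rev, Qm - z.1)) - (ψ₁ (z.2, z.1) - ψ₂ (z.2, z.1)) * Wd t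
                (z.2.rev, Qm - z.1))) : ℝ) : ℂ)) z *
          ((if z.1 ∈ klBall L μ 0 then
              V₁ t ![(((omega0 M, z.1), 0), 0), ((((omega0 M).rev, Qm - z.1), 1), 0), ((((omega0 M).rev, Qm - x), 1), 1), (((omega0 M, x), 0), 1)] *
                V₁ t ![(((omega0 M, y), 0), 0), ((((omega0 M).rev, Qm - y), 1), 0), ((((omega0 M).rev, Qm - z.1), 1), 1), (((omega0 M, z.1), 0), 1)]
            else 0) -
            V₁ t ![(((z.2, z.1), 0), 0), (((z.2.rev, Qm - z.1), 1), 0), ((((omega0 M).rev, Qm - x), 1), 1), (((omega0 M, x), 0), 1)] *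
              V₁ t ![(((omega0 M, y), 0), 0), ((((omega0 M).rev, Qm - y), 1), 0), (((z.2.rev, Qm - z.1), 1), 1), (((z.2, z.1), 0), 1)]) +
          ∑ z : TorusSite 2 L × MatsubaraIdx M, Br₂ t z *
          (((if z.1 ∈ klBall L μ 0 then
              V₁ t ![(((omega0 M, z.1), 0), 0), ((((omega0 M).rev, Qm - z.1), 1), 0), ((((omega0 M).rev, Qm - x), 1), 1), (((omega0 M, x), 0), 1)] *
                V₁ t ![(((omega0 M, y), 0), 0), ((((omega0 M).rev, Qm - y), 1), 0), ((((omega0 M).rev, Qm - z.1), 1), 1), (((omega0 M, z.1), 0), 1)]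
            else 0) -
            V₁ t ![(((z.2, z.1), 0), 0), (((z.2.rev, Qm - z.1), 1), 0), ((((omega0 M).rev, Qm - x), 1), 1), (((omega0 M, x), 0), 1)] *
              V₁ t ![(((omega0 M, y), 0), 0), ((((omega0 M).rev, Qm - y), 1), 0), (((z.2.rev, Qm - z.1), 1), 1), (((z.2, z.1), 0), 1)]) -
            ((if z.1 ∈ klBall L μ 0 then
              V₂ t ![(((omega0 M, z.1), 0), 0), ((((omega0 M).rev, Qm - z.1), 1), 0), ((((omega0 M).rev, Qm - x), 1), 1), (((omega0 M, x), 0), 1)] *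
                V₂ t ![(((omega0 M, y), 0), 0), ((((omega0 M).rev, Qm - y), 1), 0), ((((omega0 M).rev, Qm - z.1), 1), 1), (((omega0 M, z.1), 0), 1)]
            else 0) -
            V₂ t ![(((z.2, z.1), 0), 0), (((z.2.rev, Qm - z.1), 1), 0), ((((omega0 M).rev, Qm - x), 1), 1), (((omega0 M, x), 0), 1)] *
              V₂ t ![(((omega0 M, y), 0), 0), ((((omega0 M).rev, Qm - y), 1), 0), (((z.2.rev, Qm - z.1), 1), 1), (((z.2, z.1), 0), 1)])))
      else 0 := by
  rw [klmd_pinnedDefect_eq_resolved L M β U μ K hβ n hψ₁ Qm A₁ A₁' b₁' hA₁def hA₁'def hb₁'def V₁ hV₁ V6₁ hV6₁ Sg₁ hSg₁ Hd₁ hHd₁ Φ₁ hΦ₁ Wd hWd Br₁ hBr₁ ht x y,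
    klmd_pinnedDefect_eq_resolved L M β U μ K hβ n hψ₂ Qm A₂ A₂' b₂' hA₂def hA₂'def hb₂'def V₂ hV₂ V6₂ hV6₂ Sg₂ hSg₂ Hd₂ hHd₂ Φ₂ hΦ₂ Wd hWd Br₂ hBr₂ ht x y]
  have hΦ : ∀ p : FreqMomentum L M, Φ₁ t p = (fun k : FreqMomentum L M => ψ₁ k - ψ₂ k) p + Φ₂ t p := by
    intro p; simp only [hΦ₁, hΦ₂]; ring
  have hP := klmd_phd_sub_eq L M β μ K Qm x y (V₁ t) (V₂ t) (Φ₁ t) (Φ₂ t) (Wd t) (fun k : FreqMomentum L M => ψ₁ k - ψ₂ k) hΦ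
  have hX := klmd_phx_sub_eq L M β μ K Qm x y (V₁ t) (V₂ t) (Φ₁ t) (Φ₂ t) (Wd t) (fun k : FreqMomentum L M => ψ₁ k - ψ₂ k) hΦ
  have hS := klmd_s62_sub_eq L M β μ K Qm x y (V6₁ t) (V6₂ t) (Sg₁ t) (Sg₂ t) (Φ₁ t) (Φ₂ t) (Wd t) (fun k : FreqMomentum L M => ψ₁ k - ψ₂ k) hΦ
  have hBr : ∀ z : TorusSite 2 L × MatsubaraIdx M, Br₁ t z - Br₂ t z =
      -(((((β * (L : ℝ) ^ 2 : ℝ) : ℂ)))⁻¹ * propCT L M β μ K (z.2, z.1) * propCT L M β μ K (z.2.rev, Qm - z.1)) * ((((klScale klE0 (n + 1) - klScale klE0 n) * (-Wd t (z.2, z.1) * (fun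
              k : FreqMomentum L M => ψ₁ k - ψ₂ k) (z.2.rev, Qm - z.1) - (fun k : FreqMomentum L M => ψ₁ k - ψ₂ k) (z.2, z.1) * Wd t (z.2.rev, Qm - z.1))) : ℝ) : ℂ) := by
    intro z; simp only [hBr₁, hBr₂, hΦ₁, hΦ₂]; push_cast; ring
  have hL := klmd_loc_sub_eq L M β μ K n Qm x y (V₁ t) (V₂ t) (Wd t) (fun k : FreqMomentum L M => ψ₁ k - ψ₂ k) (Br₁ t) (Br₂ t) hBr
  beta_reduce at hP hX hS hL
  split_ifs
  · linear_combination (-(((((klScale klE0 (n + 1) - klScale klE0 n)) : ℝ) : ℂ) * ((((β * (L : ℝ) ^ 2 : ℝ) : ℂ)) ^ 3)⁻¹)) * hP + (((((klScale klE0 (n + 1) - klScale klE0 n)) : ℝ) : ℂ)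
          * ((((β * (L : ℝ) ^ 2 : ℝ) : ℂ)) ^ 3)⁻¹) * hX + (2 * (((((klScale klE0 (n + 1) - klScale klE0 n)) : ℝ) : ℂ) * ((((β * (L : ℝ) ^ 2 : ℝ) : ℂ)) ^ 3)⁻¹)) * hS + hL
  · simp


end Summit.HubbardSuperconductivity.HubbardSuperconductivity.Theorems.KLRegimeSplit

end
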